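import Summits.SmoothPoincare4.SmoothPoincare4.Theorems.EntropyRungNoncompactShrinkerGapHeatFisherCutoff
import Summits.SmoothPoincare4.SmoothPoincare4.Theorems.EntropyRungNoncompactShrinkerGapHeatEntropyCutoff
import Literature.Geometry.Riemannian.LinearHeatForcedExistence
import Literature.Geometry.Lorentzian.BlackHoles
import Literature.Analysis.FluidPDE.WeightedParametricIntegral

/-!
# The Bakry–Émery entropy inequality with ONE cut-off along the weighted heat flow on a complete manifold
# (crux `EntropyRung.NoncompactShrinkerGap`, stmt-SmoothPoincare4-10868, line `collapsed-ends-usc`, v13)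

Helper of the registered stub `stub_compactSupportLSI`. Setting: `(M, g)` modelled on `ℝⁿ` (NOT compact),
`Ric + Hess V ≥ K g` with `K > 0`, `L = Δ − g⁻¹(dV, d·)`, a positive solution `ρ` of `∂ₜρ = Lρ` on `[0, T]` (smooth on
`M × O`, `O ⊇ [0,T]` open) with `c ≤ ρ ≤ C'` and `|∇ρ|² ≤ G`, and a smooth compactly supported cut-off `0 ≤ η`.
With `A(t) = ∫ η |∇ρ|²/ρ e^{-V}` (cut-off Fisher information) and `B(t) = ∫ η ρ log ρ e^{-V}` (cut-off entropy):

  `B(0) − B(T) ≤ (1/2K) A(0) + T · (C' Λ + G/(2Kc)) · ∫ |Lη| e^{-V}`,  `Λ = max(|log c|, |log C'|)`   (`cutoffEntropy_le`).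

Proof: `A` and `B` are continuous on `[0,T]` and differentiable on `(0,T)` (differentiation under the integral sign
against the compactly supported weight `η e^{-V}`), with `A' ≤ −2K A + R` (`fisherCutoff_le`) and `B' = −A + S`
(`entropyCutoff_eq`), where the boundary terms satisfy `|R| ≤ (G/c) ∫|Lη|e^{-V}`, `|S| ≤ C'Λ ∫|Lη|e^{-V}`; hence
`Θ = B − A/2K + e·t` is monotone (`monotoneOn_of_deriv_nonneg`), which is the claim since `A(T) ≥ 0`.
No Grönwall lemma and no integral in time is needed. Everything is proved; no definitions.
-/

noncomputable section

set_option linter.dupNamespace false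

open scoped Manifold ContDiff ENNReal NNReal Topology
open MeasureTheory Set Filter
open Literature.Geometry.Lorentzian Literature.Geometry.Riemannian

namespace Summit.SmoothPoincare4.SmoothPoincare4.Theorems.NoncompactShrinkerGapHeat

section OneCutoff

variable {n : ℕ} {M : Type*} [TopologicalSpace M] [T2Space M] [SecondCountableTopology M]
  [ChartedSpace (EuclideanSpace ℝ (Fin n)) M] [IsManifold (𝓡 n) ∞ M] [T3Space M] [MeasurableSpace M]
  [BorelSpace M]
  {g : PseudoRiemannianMetric (𝓡 n) ∞ (EuclideanSpace ℝ (Fin n)) (TangentSpace (𝓡 n) : M → Type _)}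
  [g.HasLeviCivita]

omit [T2Space M] [SecondCountableTopology M] [T3Space M] [MeasurableSpace M] [BorelSpace M] [g.HasLeviCivita] in
/-- `|∇(−log ρ)|² e^{log ρ} = |∇ρ|²/ρ` at a point where `ρ > 0`. [folklore] -/
theorem gradSq_negLog_mul_exp {ρ : M → ℝ} {x : M} (hρ : MDifferentiableAt (𝓡 n) 𝓘(ℝ, ℝ) ρ x) (hpos : 0 < ρ x) :
    g.gradSq (fun y ↦ -Real.log (ρ y)) x * Real.exp (-(-Real.log (ρ x))) = g.gradSq ρ x / ρ x := by
  have hd : HasDerivAt (fun s : ℝ ↦ -Real.log s) (-(ρ x)⁻¹) (ρ x) := (Real.hasDerivAt_log hpos.ne').neg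
  have h := g.gradSq_real_comp (h := fun s : ℝ ↦ -Real.log s) hd hρ
  rw [show (fun y ↦ -Real.log (ρ y)) = (fun s : ℝ ↦ -Real.log s) ∘ ρ from rfl, h, neg_neg,
    Real.exp_log hpos]
  field_simp

omit [T2Space M] [SecondCountableTopology M] [T3Space M] [MeasurableSpace M] [BorelSpace M] [g.HasLeviCivita] in
/-- `|x log x| ≤ C' max(|log c|, |log C'|)` for `0 < c ≤ x ≤ C'`. [folklore] -/
theorem abs_mul_log_le {c C' x : ℝ} (hc : 0 < c) (hcx : c ≤ x) (hxC : x ≤ C') :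
    |x * Real.log x| ≤ C' * max |Real.log c| |Real.log C'| := by
  have hx : 0 < x := hc.trans_le hcx
  have hlog : |Real.log x| ≤ max |Real.log c| |Real.log C'| := by
    rw [abs_le]
    constructor
    · have h1 : Real.log c ≤ Real.log x := Real.log_le_log hc hcx
      have h2 : -|Real.log c| ≤ Real.log c := neg_abs_le _
      linarith [le_max_left |Real.log c| |Real.log C'|]
    · have h1 : Real.log x ≤ Real.log C' := Real.log_le_log hx hxC
      linarith [le_abs_self (Real.log C'), le_max_right |Real.log c| |Real.log C'|]
  rw [abs_mul, abs_of_pos hx]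
  exact mul_le_mul hxC hlog (abs_nonneg _) (hx.le.trans hxC)

/-- **The Bakry–Émery entropy inequality with one cut-off** (see the module docstring). -/
theorem cutoffEntropy_le (hg : g.IsRiemannian) {V : M → ℝ} {K : ℝ} (hV : ContMDiff (𝓡 n) 𝓘(ℝ, ℝ) ∞ V)
    (hK : 0 < K)
    (hRic : ∀ (y : M) (X : TangentSpace (𝓡 n) y), K * g.val y X X ≤ g.ricci y X X + g.hessian V y X X)
    {T : ℝ} {O : Set ℝ} {ρ : ℝ → M → ℝ} (hT : 0 < T) (hO : IsOpen O) (hTO : Icc 0 T ⊆ O)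
    (hρ : ContMDiffOn ((𝓡 n).prod 𝓘(ℝ, ℝ)) 𝓘(ℝ, ℝ) ∞ (fun p : M × ℝ ↦ ρ p.2 p.1) (univ ×ˢ O))
    (heq : ∀ s ∈ Icc 0 T, ∀ x, deriv (fun r ↦ ρ r x) s = g.dalembertian (ρ s) x
      - g.innerDual x (mvfderiv (𝓡 n) V x).toLinearMap (mvfderiv (𝓡 n) (ρ s) x).toLinearMap)
    {c C' G : ℝ} (hc : 0 < c) (hbd : ∀ s ∈ Icc 0 T, ∀ x, c ≤ ρ s x ∧ ρ s x ≤ C')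
    (hgrad : ∀ s ∈ Icc 0 T, ∀ x, g.gradSq (ρ s) x ≤ G)
    {η : M → ℝ} (hη : ContMDiff (𝓡 n) 𝓘(ℝ, ℝ) ∞ η) (hηc : HasCompactSupport η) (hη0 : ∀ y, 0 ≤ η y) :
    (∫ y, η y * (ρ 0 y * Real.log (ρ 0 y) * Real.exp (-V y)) ∂g.riemVolume)
      - (∫ y, η y * (ρ T y * Real.log (ρ T y) * Real.exp (-V y)) ∂g.riemVolume) ≤
      1 / (2 * K) * ∫ y, η y * (g.gradSq (ρ 0) y / ρ 0 y * Real.exp (-V y)) ∂g.riemVolume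
      + T * ((C' * max |Real.log c| |Real.log C'| + G / c / (2 * K)) *
          ∫ y, |g.dalembertian η y - g.innerDual y (mvfderiv (𝓡 n) V y).toLinearMap
            (mvfderiv (𝓡 n) η y).toLinearMap| * Real.exp (-V y) ∂g.riemVolume) := by
  haveI := CarrilloNi2009_shrinkerLSI.isFiniteMeasureOnCompacts_riemVolume hg
  -- the time set `S = [0, T]`
  set S : Set ℝ := Icc 0 T with hSdef
  have hS : UniqueDiffOn ℝ S := uniqueDiffOn_Icc hT
  have hS' : S ⊆ closure (interior S) := by
    rw [hSdef, interior_Icc, closure_Ioo hT.ne]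
  have hρS : ContMDiffOn ((𝓡 n).prod 𝓘(ℝ, ℝ)) 𝓘(ℝ, ℝ) ∞ (fun p : M × ℝ ↦ ρ p.2 p.1) (univ ×ˢ S) :=
    hρ.mono (prod_mono le_rfl hTO)
  have hpos : ∀ t ∈ S, ∀ y, 0 < ρ t y := fun t ht y ↦ hc.trans_le (hbd t ht y).1
  have hV1 : ContMDiff (𝓡 n) 𝓘(ℝ, ℝ) 1 V := hV.of_le (by norm_num)
  -- the equation within `S`
  have hdS : ∀ t ∈ S, ∀ y, HasDerivAt (fun r ↦ ρ r y) (deriv (fun r ↦ ρ r y) t) t := fun t ht y ↦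
    hasDerivAt_slice_of_contMDiffOn hO (v := fun p : M × ℝ ↦ ρ p.2 p.1) hρ y (hTO ht)
  have heqS : ∀ t ∈ S, ∀ y, derivWithin (fun r ↦ ρ r y) S t = g.dalembertian (ρ t) y
      - g.innerDual y (mvfderiv (𝓡 n) V y).toLinearMap (mvfderiv (𝓡 n) (ρ t) y).toLinearMap := by
    intro t ht y
    rw [(hdS t ht y).differentiableAt.derivWithin (hS t ht)]
    exact heq t ht y
  -- `φ = −log ρ` solves `∂ₜφ = Lφ − |∇φ|²` within `S`
  have hφ : ContMDiffOn ((𝓡 n).prod 𝓘(ℝ, ℝ)) 𝓘(ℝ, ℝ) ∞ (fun p : M × ℝ ↦ -Real.log (ρ p.2 p.1)) (univ ×ˢ S) := by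
    intro p hp
    have hne : ρ p.2 p.1 ≠ 0 := (hpos p.2 hp.2 p.1).ne'
    exact ((Real.contDiffAt_log.2 hne).comp_contMDiffWithinAt (f := fun p : M × ℝ ↦ ρ p.2 p.1) (x := p)
      (hρS p hp)).neg
  have hslice : ∀ t ∈ S, ContMDiff (𝓡 n) 𝓘(ℝ, ℝ) ∞ (ρ t) := fun t ht ↦
    hρS.comp_contMDiff (contMDiff_id.prodMk contMDiff_const) fun y ↦ ⟨mem_univ _, ht⟩
  have heqφ : ∀ t ∈ S, ∀ y : M, derivWithin (fun s ↦ -Real.log (ρ s y)) S t =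
      g.dalembertian (fun y ↦ -Real.log (ρ t y)) y
        - g.innerDual y (mvfderiv (𝓡 n) V y).toLinearMap
            (mvfderiv (𝓡 n) (fun y ↦ -Real.log (ρ t y)) y).toLinearMap
        - g.gradSq (fun y ↦ -Real.log (ρ t y)) y := by
    intro t ht y
    have hut : ContMDiffAt (𝓡 n) 𝓘(ℝ, ℝ) 2 (ρ t) y :=
      ((hslice t ht).of_le (WithTop.coe_le_coe.mpr le_top)).contMDiffAt
    have hd : HasDerivWithinAt (fun s ↦ ρ s y) (derivWithin (fun s ↦ ρ s y) S t) S t :=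
      hasDerivWithinAt_time_of_contMDiffOn (by simp) hρS y ht
    exact negLog_heat_equation g hut (hpos t ht y) hd (hS t ht) (heqS t ht y)
  -- the two space-time integrands: Fisher (in `φ`-form) and entropy
  have hFfam : ContMDiffOn ((𝓡 n).prod 𝓘(ℝ, ℝ)) 𝓘(ℝ, ℝ) ∞ (fun p : M × ℝ ↦
      g.gradSq (fun z ↦ -Real.log (ρ p.2 z)) p.1 * Real.exp (-(-Real.log (ρ p.2 p.1))) * Real.exp (-V p.1))
      (univ ×ˢ S) := by
    have hq := contMDiffOn_gradSq_family g hS (f := fun t y ↦ -Real.log (ρ t y)) hφ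
    have hu : ContMDiffOn ((𝓡 n).prod 𝓘(ℝ, ℝ)) 𝓘(ℝ, ℝ) ∞ (fun p : M × ℝ ↦ Real.exp (-(-Real.log (ρ p.2 p.1))))
        (univ ×ˢ S) := (Real.contDiff_exp.comp contDiff_neg).contMDiff.comp_contMDiffOn hφ
    have hw : ContMDiffOn ((𝓡 n).prod 𝓘(ℝ, ℝ)) 𝓘(ℝ, ℝ) ∞ (fun p : M × ℝ ↦ Real.exp (-V p.1)) (univ ×ˢ S) :=
      ((Real.contDiff_exp.comp contDiff_neg).comp_contMDiff (hV.comp contMDiff_fst)).contMDiffOn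
    exact (hq.mul hu).mul hw
  have hEfam : ContMDiffOn ((𝓡 n).prod 𝓘(ℝ, ℝ)) 𝓘(ℝ, ℝ) ∞ (fun p : M × ℝ ↦
      ρ p.2 p.1 * Real.log (ρ p.2 p.1) * Real.exp (-V p.1)) (univ ×ˢ S) := by
    have hl : ContMDiffOn ((𝓡 n).prod 𝓘(ℝ, ℝ)) 𝓘(ℝ, ℝ) ∞ (fun p : M × ℝ ↦ Real.log (ρ p.2 p.1)) (univ ×ˢ S) := by
      intro p hp
      exact (Real.contDiffAt_log.2 (hpos p.2 hp.2 p.1).ne').comp_contMDiffWithinAt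
        (f := fun p : M × ℝ ↦ ρ p.2 p.1) (x := p) (hρS p hp)
    have hw : ContMDiffOn ((𝓡 n).prod 𝓘(ℝ, ℝ)) 𝓘(ℝ, ℝ) ∞ (fun p : M × ℝ ↦ Real.exp (-V p.1)) (univ ×ˢ S) :=
      ((Real.contDiff_exp.comp contDiff_neg).comp_contMDiff (hV.comp contMDiff_fst)).contMDiffOn
    exact (hρS.mul hl).mul hw
  have hF'fam := contMDiffOn_derivWithin_time_of_uniqueDiffOn (u := fun t y ↦
      g.gradSq (fun z ↦ -Real.log (ρ t z)) y * Real.exp (-(-Real.log (ρ t y))) * Real.exp (-V y)) hS hFfam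
  have hE'fam := contMDiffOn_derivWithin_time_of_uniqueDiffOn (u := fun t y ↦
      ρ t y * Real.log (ρ t y) * Real.exp (-V y)) hS hEfam
  -- the curves
  set A : ℝ → ℝ := fun t ↦ ∫ y, η y * (g.gradSq (fun z ↦ -Real.log (ρ t z)) y *
      Real.exp (-(-Real.log (ρ t y))) * Real.exp (-V y)) ∂g.riemVolume with hAdef
  set B : ℝ → ℝ := fun t ↦ ∫ y, η y * (ρ t y * Real.log (ρ t y) * Real.exp (-V y)) ∂g.riemVolume with hBdef
  set DA : ℝ → ℝ := fun t ↦ ∫ y, η y * derivWithin (fun s ↦ g.gradSq (fun z ↦ -Real.log (ρ s z)) y *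
      Real.exp (-(-Real.log (ρ s y))) * Real.exp (-V y)) S t ∂g.riemVolume with hDAdef
  set DB : ℝ → ℝ := fun t ↦ ∫ y, η y * derivWithin (fun s ↦ ρ s y * Real.log (ρ s y) * Real.exp (-V y)) S t
      ∂g.riemVolume with hDBdef
  set R : ℝ → ℝ := fun t ↦ ∫ y, g.gradSq (fun z ↦ -Real.log (ρ t z)) y * Real.exp (-(-Real.log (ρ t y))) *
      (g.dalembertian η y - g.innerDual y (mvfderiv (𝓡 n) V y).toLinearMap (mvfderiv (𝓡 n) η y).toLinearMap) *
      Real.exp (-V y) ∂g.riemVolume with hRdef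
  set Sb : ℝ → ℝ := fun t ↦ ∫ y, ρ t y * Real.log (ρ t y) *
      (g.dalembertian η y - g.innerDual y (mvfderiv (𝓡 n) V y).toLinearMap (mvfderiv (𝓡 n) η y).toLinearMap) *
      Real.exp (-V y) ∂g.riemVolume with hSbdef
  set Aρ : ℝ → ℝ := fun t ↦ ∫ y, η y * (g.gradSq (ρ t) y / ρ t y * Real.exp (-V y)) ∂g.riemVolume with hAρdef
  set δ : ℝ := ∫ y, |g.dalembertian η y - g.innerDual y (mvfderiv (𝓡 n) V y).toLinearMap
      (mvfderiv (𝓡 n) η y).toLinearMap| * Real.exp (-V y) ∂g.riemVolume with hδdef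
  set Λ : ℝ := max |Real.log c| |Real.log C'| with hΛdef
  -- (f1), (f2): the two differential relations at each `t ∈ S`
  have f1 : ∀ t ∈ S, DA t ≤ -2 * K * A t + R t := fun t ht ↦
    fisherCutoff_le hg hV hRic hS hS' (φ := fun t y ↦ -Real.log (ρ t y)) hφ heqφ hη hηc hη0 ht
  have f2 : ∀ t ∈ S, DB t = -(Aρ t) + Sb t := fun t ht ↦
    entropyCutoff_eq hg hV hS hρS hpos heqS hη hηc ht
  -- (f3): `A = Aρ` on `S`
  have f3 : ∀ t ∈ S, A t = Aρ t := by
    intro t ht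
    refine integral_congr_ae (Eventually.of_forall fun y ↦ ?_)
    dsimp only
    rw [gradSq_negLog_mul_exp ((hslice t ht).mdifferentiableAt (by simp)) (hpos t ht y)]
  -- regularity of the slices, supports, integrability
  have hηcont : Continuous η := hη.continuous
  have hη1 : ContMDiff (𝓡 n) 𝓘(ℝ, ℝ) 1 η := hη.of_le (by norm_num)
  have hη2 : ContMDiff (𝓡 n) 𝓘(ℝ, ℝ) 2 η := hη.of_le (WithTop.coe_le_coe.mpr le_top)
  have hLηc : Continuous fun y ↦ g.dalembertian η y - g.innerDual y (mvfderiv (𝓡 n) V y).toLinearMap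
      (mvfderiv (𝓡 n) η y).toLinearMap :=
    (continuous_dalembertian g hη2).sub (continuous_innerDual_mvfderiv g hV1 hη1)
  have hLηsupp : HasCompactSupport fun y ↦ g.dalembertian η y - g.innerDual y (mvfderiv (𝓡 n) V y).toLinearMap
      (mvfderiv (𝓡 n) η y).toLinearMap := by
    refine HasCompactSupport.intro hηc fun y hy ↦ ?_
    rw [g.dalembertian_eq_zero_of_notMem_tsupport hy, innerDual_mvfderiv_eq_zero_of_notMem_tsupport_right hy]
    ring
  have hWc : Continuous fun y ↦ Real.exp (-V y) := Real.continuous_exp.comp hV.continuous.neg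
  have hsliceF : ∀ t ∈ S, Continuous fun y ↦ g.gradSq (fun z ↦ -Real.log (ρ t z)) y *
      Real.exp (-(-Real.log (ρ t y))) * Real.exp (-V y) := fun t ht ↦
    (hFfam.continuousOn.comp_continuous (continuous_id.prodMk continuous_const) fun y ↦ ⟨mem_univ _, ht⟩ :)
  have hsliceE : ∀ t ∈ S, Continuous fun y ↦ ρ t y * Real.log (ρ t y) * Real.exp (-V y) := fun t ht ↦
    (hEfam.continuousOn.comp_continuous (continuous_id.prodMk continuous_const) fun y ↦ ⟨mem_univ _, ht⟩ :)
  -- (f4), (f5): the boundary terms are bounded by multiples of `δ`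
  have hPbd : ∀ t ∈ S, ∀ y, 0 ≤ g.gradSq (fun z ↦ -Real.log (ρ t z)) y * Real.exp (-(-Real.log (ρ t y))) ∧
      g.gradSq (fun z ↦ -Real.log (ρ t z)) y * Real.exp (-(-Real.log (ρ t y))) ≤ G / c := by
    intro t ht y
    rw [gradSq_negLog_mul_exp ((hslice t ht).mdifferentiableAt (by simp)) (hpos t ht y)]
    have hρy := hbd t ht y
    have hGy := hgrad t ht y
    have hQ0 : 0 ≤ g.gradSq (ρ t) y := g.gradSq_nonneg hg _ _
    have hρpos := hpos t ht y
    refine ⟨div_nonneg hQ0 hρpos.le, ?_⟩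
    rw [div_le_div_iff₀ hρpos hc]
    nlinarith
  have iδ : Integrable (fun y ↦ |g.dalembertian η y - g.innerDual y (mvfderiv (𝓡 n) V y).toLinearMap
      (mvfderiv (𝓡 n) η y).toLinearMap| * Real.exp (-V y)) g.riemVolume :=
    integrable_of_continuous_of_hasCompactSupport' hg (hLηc.abs.mul hWc) hLηsupp.abs.mul_right
  have f4 : ∀ t ∈ S, |R t| ≤ G / c * δ := by
    intro t ht
    have hcont : Continuous fun y ↦ g.gradSq (fun z ↦ -Real.log (ρ t z)) y * Real.exp (-(-Real.log (ρ t y))) *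
        (g.dalembertian η y - g.innerDual y (mvfderiv (𝓡 n) V y).toLinearMap (mvfderiv (𝓡 n) η y).toLinearMap) *
        Real.exp (-V y) := by
      have hPc : Continuous fun y ↦ g.gradSq (fun z ↦ -Real.log (ρ t z)) y * Real.exp (-(-Real.log (ρ t y))) := by
        have h1 : ContMDiff (𝓡 n) 𝓘(ℝ, ℝ) ∞ (fun z ↦ -Real.log (ρ t z)) :=
          hφ.comp_contMDiff (contMDiff_id.prodMk contMDiff_const) fun y ↦ ⟨mem_univ _, ht⟩
        exact (contMDiff_gradSq g h1).continuous.mul (Real.continuous_exp.comp h1.continuous.neg)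
      exact (hPc.mul hLηc).mul hWc
    calc |R t| ≤ ∫ y, |g.gradSq (fun z ↦ -Real.log (ρ t z)) y * Real.exp (-(-Real.log (ρ t y))) *
          (g.dalembertian η y - g.innerDual y (mvfderiv (𝓡 n) V y).toLinearMap (mvfderiv (𝓡 n) η y).toLinearMap) *
          Real.exp (-V y)| ∂g.riemVolume := abs_integral_le_integral_abs
      _ ≤ ∫ y, G / c * (|g.dalembertian η y - g.innerDual y (mvfderiv (𝓡 n) V y).toLinearMap
          (mvfderiv (𝓡 n) η y).toLinearMap| * Real.exp (-V y)) ∂g.riemVolume := by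
          refine integral_mono ?_ (iδ.const_mul _) fun y ↦ ?_
          · exact (integrable_of_continuous_of_hasCompactSupport' hg hcont
              (hLηsupp.mul_left.mul_right)).abs
          · dsimp only
            obtain ⟨hP0, hPle⟩ := hPbd t ht y
            rw [abs_mul, abs_mul, abs_of_nonneg hP0, abs_of_nonneg (Real.exp_pos _).le]
            have hw0 : 0 ≤ Real.exp (-V y) := (Real.exp_pos _).le
            have ha0 := abs_nonneg (g.dalembertian η y - g.innerDual y (mvfderiv (𝓡 n) V y).toLinearMap
              (mvfderiv (𝓡 n) η y).toLinearMap)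
            nlinarith [mul_le_mul_of_nonneg_right hPle (mul_nonneg ha0 hw0)]
      _ = G / c * δ := integral_const_mul _ _
  have f5 : ∀ t ∈ S, |Sb t| ≤ C' * Λ * δ := by
    intro t ht
    have hcont : Continuous fun y ↦ ρ t y * Real.log (ρ t y) *
        (g.dalembertian η y - g.innerDual y (mvfderiv (𝓡 n) V y).toLinearMap (mvfderiv (𝓡 n) η y).toLinearMap) *
        Real.exp (-V y) := by
      have h1 : Continuous fun y ↦ ρ t y * Real.log (ρ t y) :=
        (hslice t ht).continuous.mul ((hslice t ht).continuous.log fun y ↦ (hpos t ht y).ne')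
      exact (h1.mul hLηc).mul hWc
    calc |Sb t| ≤ ∫ y, |ρ t y * Real.log (ρ t y) *
          (g.dalembertian η y - g.innerDual y (mvfderiv (𝓡 n) V y).toLinearMap (mvfderiv (𝓡 n) η y).toLinearMap) *
          Real.exp (-V y)| ∂g.riemVolume := abs_integral_le_integral_abs
      _ ≤ ∫ y, C' * Λ * (|g.dalembertian η y - g.innerDual y (mvfderiv (𝓡 n) V y).toLinearMap
          (mvfderiv (𝓡 n) η y).toLinearMap| * Real.exp (-V y)) ∂g.riemVolume := by
          refine integral_mono ?_ (iδ.const_mul _) fun y ↦ ?_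
          · exact (integrable_of_continuous_of_hasCompactSupport' hg hcont
              (hLηsupp.mul_left.mul_right)).abs
          · dsimp only
            have hxl := abs_mul_log_le hc (hbd t ht y).1 (hbd t ht y).2
            rw [abs_mul, abs_mul, abs_of_nonneg (Real.exp_pos _).le]
            have hw0 : 0 ≤ Real.exp (-V y) := (Real.exp_pos _).le
            have ha0 := abs_nonneg (g.dalembertian η y - g.innerDual y (mvfderiv (𝓡 n) V y).toLinearMap
              (mvfderiv (𝓡 n) η y).toLinearMap)
            nlinarith [mul_le_mul_of_nonneg_right hxl (mul_nonneg ha0 hw0)]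
      _ = C' * Λ * δ := integral_const_mul _ _
  -- (f6), (f7): continuity on `S` and differentiability on the interior, under the integral sign
  have hswapF : ContinuousOn (Function.uncurry fun t y ↦ g.gradSq (fun z ↦ -Real.log (ρ t z)) y *
      Real.exp (-(-Real.log (ρ t y))) * Real.exp (-V y)) (S ×ˢ univ) := by
    have h1 := hFfam.continuousOn.comp continuous_swap.continuousOn
      (fun (q : ℝ × M) (hq : q ∈ S ×ˢ (univ : Set M)) ↦ show q.swap ∈ univ ×ˢ S from ⟨mem_univ _, hq.1⟩)
    refine h1.congr ?_
    rintro ⟨t, y⟩ _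
    rfl
  have hswapF' : ContinuousOn (Function.uncurry fun t y ↦ derivWithin (fun s ↦ g.gradSq (fun z ↦ -Real.log (ρ s z)) y *
      Real.exp (-(-Real.log (ρ s y))) * Real.exp (-V y)) S t) (Ioo 0 T ×ˢ univ) := by
    have h1 := hF'fam.continuousOn.comp continuous_swap.continuousOn
      (fun (q : ℝ × M) (hq : q ∈ Ioo 0 T ×ˢ (univ : Set M)) ↦
        show q.swap ∈ univ ×ˢ S from ⟨mem_univ _, Ioo_subset_Icc_self hq.1⟩)
    refine h1.congr ?_
    rintro ⟨t, y⟩ _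
    rfl
  have hswapE : ContinuousOn (Function.uncurry fun t y ↦ ρ t y * Real.log (ρ t y) * Real.exp (-V y))
      (S ×ˢ univ) := by
    have h1 := hEfam.continuousOn.comp continuous_swap.continuousOn
      (fun (q : ℝ × M) (hq : q ∈ S ×ˢ (univ : Set M)) ↦ show q.swap ∈ univ ×ˢ S from ⟨mem_univ _, hq.1⟩)
    refine h1.congr ?_
    rintro ⟨t, y⟩ _
    rfl
  have hswapE' : ContinuousOn (Function.uncurry fun t y ↦ derivWithin (fun s ↦ ρ s y * Real.log (ρ s y) *
      Real.exp (-V y)) S t) (Ioo 0 T ×ˢ univ) := by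
    have h1 := hE'fam.continuousOn.comp continuous_swap.continuousOn
      (fun (q : ℝ × M) (hq : q ∈ Ioo 0 T ×ˢ (univ : Set M)) ↦
        show q.swap ∈ univ ×ˢ S from ⟨mem_univ _, Ioo_subset_Icc_self hq.1⟩)
    refine h1.congr ?_
    rintro ⟨t, y⟩ _
    rfl
  have f6A : ContinuousOn A S := by
    have h := Literature.Analysis.FluidPDE.continuousOn_integral_smul_of_continuousOn (μ := g.riemVolume)
      hηcont hηc hswapF
    simp only [smul_eq_mul] at h
    exact h
  have f6B : ContinuousOn B S := by
    have h := Literature.Analysis.FluidPDE.continuousOn_integral_smul_of_continuousOn (μ := g.riemVolume)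
      hηcont hηc hswapE
    simp only [smul_eq_mul] at h
    exact h
  have f7A : ∀ t ∈ Ioo 0 T, HasDerivAt A (DA t) t := by
    intro t ht
    have hder : ∀ s ∈ Ioo 0 T, ∀ y, HasDerivAt (fun r ↦ g.gradSq (fun z ↦ -Real.log (ρ r z)) y *
        Real.exp (-(-Real.log (ρ r y))) * Real.exp (-V y)) (derivWithin (fun r ↦ g.gradSq (fun z ↦ -Real.log (ρ r z)) y *
        Real.exp (-(-Real.log (ρ r y))) * Real.exp (-V y)) S s) s := fun s hs y ↦
      (hasDerivWithinAt_time_of_contMDiffOn (k := ∞) (u := fun t y ↦ g.gradSq (fun z ↦ -Real.log (ρ t z)) y *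
        Real.exp (-(-Real.log (ρ t y))) * Real.exp (-V y)) (by simp) hFfam y (Ioo_subset_Icc_self hs)).hasDerivAt
        (Icc_mem_nhds hs.1 hs.2)
    have h := Literature.Analysis.FluidPDE.hasDerivAt_integral_smul_of_continuousOn (μ := g.riemVolume)
      hηcont hηc isOpen_Ioo (hswapF.mono (prod_mono Ioo_subset_Icc_self le_rfl)) hswapF' hder ht
    simp only [smul_eq_mul] at h
    exact h
  have f7B : ∀ t ∈ Ioo 0 T, HasDerivAt B (DB t) t := by
    intro t ht
    have hder : ∀ s ∈ Ioo 0 T, ∀ y, HasDerivAt (fun r ↦ ρ r y * Real.log (ρ r y) * Real.exp (-V y))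
        (derivWithin (fun r ↦ ρ r y * Real.log (ρ r y) * Real.exp (-V y)) S s) s := fun s hs y ↦
      (hasDerivWithinAt_time_of_contMDiffOn (k := ∞) (u := fun t y ↦ ρ t y * Real.log (ρ t y) * Real.exp (-V y))
        (by simp) hEfam y (Ioo_subset_Icc_self hs)).hasDerivAt
        (Icc_mem_nhds hs.1 hs.2)
    have h := Literature.Analysis.FluidPDE.hasDerivAt_integral_smul_of_continuousOn (μ := g.riemVolume)
      hηcont hηc isOpen_Ioo (hswapE.mono (prod_mono Ioo_subset_Icc_self le_rfl)) hswapE' hder ht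
    simp only [smul_eq_mul] at h
    exact h
  -- (f8): `A T ≥ 0`
  have f8 : 0 ≤ A T := by
    refine integral_nonneg fun y ↦ ?_
    have := (hPbd T ⟨hT.le, le_rfl⟩ y).1
    exact mul_nonneg (hη0 y) (mul_nonneg this (Real.exp_pos _).le)
  -- the monotone combination `Θ = B − A/(2K) + t·e`
  set e : ℝ := (C' * Λ + G / c / (2 * K)) * δ with hedef
  set Θ : ℝ → ℝ := fun t ↦ B t - 1 / (2 * K) * A t + t * e with hΘdef
  have hK2 : 0 < 1 / (2 * K) := by positivity
  have hcontΘ : ContinuousOn Θ S := by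
    have h1 : ContinuousOn (fun t ↦ 1 / (2 * K) * A t) S := continuousOn_const.mul f6A
    have h2 : ContinuousOn (fun t : ℝ ↦ t * e) S := (continuous_id.mul continuous_const).continuousOn
    exact (f6B.sub h1).add h2
  have hdiffΘ : ∀ t ∈ Ioo 0 T, HasDerivAt Θ (DB t - 1 / (2 * K) * DA t + e) t := fun t ht ↦
    ((f7B t ht).sub ((f7A t ht).const_mul (1 / (2 * K)))).add (hasDerivAt_mul_const e)
  have hΘmono : MonotoneOn Θ S := by
    refine monotoneOn_of_deriv_nonneg (convex_Icc 0 T) hcontΘ (fun t ht ↦ ?_) (fun t ht ↦ ?_)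
    · rw [interior_Icc] at ht
      exact (hdiffΘ t ht).differentiableAt.differentiableWithinAt
    · rw [interior_Icc] at ht
      have htS : t ∈ S := Ioo_subset_Icc_self ht
      rw [(hdiffΘ t ht).deriv]
      have h1 := f1 t htS
      have h4 := (abs_le.1 (f4 t htS)).2
      have h5 := (abs_le.1 (f5 t htS)).1
      have key : 1 / (2 * K) * DA t ≤ -A t + 1 / (2 * K) * R t := by
        have := mul_le_mul_of_nonneg_left h1 hK2.le
        have hKK : 1 / (2 * K) * (2 * K) = 1 := one_div_mul_cancel (by positivity)
        linear_combination this - A t * hKK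
      have hR' : 1 / (2 * K) * R t ≤ 1 / (2 * K) * (G / c * δ) := mul_le_mul_of_nonneg_left h4 hK2.le
      have he : e = C' * Λ * δ + 1 / (2 * K) * (G / c * δ) := by rw [hedef]; ring
      linarith [key, hR', h5, f2 t htS, f3 t htS, he]
  have hTS : T ∈ S := ⟨hT.le, le_rfl⟩
  have h0S : (0 : ℝ) ∈ S := ⟨le_rfl, hT.le⟩
  have hΘ : B 0 - 1 / (2 * K) * A 0 + 0 * e ≤ B T - 1 / (2 * K) * A T + T * e := hΘmono h0S hTS hT.le
  have hA0 : A 0 = Aρ 0 := f3 0 h0S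
  have hAT : 0 ≤ 1 / (2 * K) * A T := mul_nonneg hK2.le f8
  rw [hA0] at hΘ
  have hmain : B 0 - B T ≤ 1 / (2 * K) * Aρ 0 + T * e := by linarith [hΘ, hAT]
  exact hmain

end OneCutoff

/-- Registered helper `helper_cutoffEntropy`: the Bakry–Émery entropy inequality with ONE cut-off along a bounded positive
solution of the weighted heat equation on a (non-compact) Riemannian manifold modelled on `ℝⁿ` (`cutoffEntropy_le`).
[cite: CarrilloNi2009, §3 (3.2)–(3.4) and p. 8] -/
theorem helper_cutoffEntropy : ∀ (n : ℕ) (M : Type*) [TopologicalSpace M] [T2Space M] [SecondCountableTopology M] [ChartedSpace (EuclideanSpace ℝ (Fin n)) M] [IsManifold (𝓡 n) ∞ M] [T3Space M] [MeasurableSpace M] [BorelSpace M] (g : PseudoRiemannianMetric (𝓡 n) ∞ (EuclideanSpace ℝ (Fin n)) (TangentSpace (𝓡 n) : M → Type _)) [g.HasLeviCivita] (V : M → ℝ) (K : ℝ), g.IsRiemannian → ContMDiff (𝓡 n) 𝓘(ℝ, ℝ) ∞ V → 0 < K → (∀ (x : M) (X : TangentSpace (𝓡 n) x), K * g.val x X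 X ≤ g.ricci x X X + g.hessian V x X X) → ∀ (T : ℝ) (O : Set ℝ) (ρ : ℝ → M → ℝ), 0 < T → IsOpen O → Icc 0 T ⊆ O → ContMDiffOn ((𝓡 n).prod 𝓘(ℝ, ℝ)) 𝓘(ℝ, ℝ) ∞ (fun p : M × ℝ ↦ ρ p.2 p.1) (univ ×ˢ O) → (∀ s ∈ Icc 0 T, ∀ x, deriv (fun r ↦ ρ r x) s = g.dalembertian (ρ s) x - g.innerDual x (mvfderiv (𝓡 n) V x).toLinearMap (mvfderiv (𝓡 n) (ρ s) x).toLinearMap) → ∀ (c C' G : ℝ), 0 < c → (∀ s ∈ Icc 0 T, ∀ x, c ≤ ρ s x ∧ ρ s x ≤ C') → (∀ s ∈ Icc 0 T, ∀ x, g.gradSq (ρ s) x ≤ G) → ∀ (η : M → ℝ), ContMDiff (𝓡 n) 𝓘(ℝ, ℝ) ∞ η → HasCompactSupport η → (∀ y, 0 ≤ η y) → (∫ y, η y * (ρ 0 y * Real.log (ρ 0 y) * Real.exp (-V y)) ∂g.riemVolume) - (∫ y, η y * (ρ T y * Real.log (ρ T y) * Real.exp (-V y)) ∂g.riemVolume)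 ≤ 1 / (2 * K) * ∫ y, η y * (g.gradSq (ρ 0) y / ρ 0 y * Real.exp (-V y)) ∂g.riemVolume + T * ((C' * max |Real.log c| |Real.log C'| + G / c / (2 * K)) * ∫ y, |g.dalembertian η y - g.innerDual y (mvfderiv (𝓡 n) V y).toLinearMap (mvfderiv (𝓡 n) η y).toLinearMap| * Real.exp (-V y) ∂g.riemVolume) := by
  intro n M _ _ _ _ _ _ _ _ g _ V K hg hV hK hRic T O ρ hT hO hTO hρ heq c C' G hc hbd hgrad η hη hηc hη0
  exact cutoffEntropy_le hg hV hK hRic hT hO hTO hρ heq hc hbd hgrad hη hηc hη0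


end Summit.SmoothPoincare4.SmoothPoincare4.Theorems.NoncompactShrinkerGapHeat

end
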